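import Mathlib.AlgebraicGeometry.Morphisms.Smooth
import Mathlib.AlgebraicGeometry.Morphisms.UniversallyOpen
import Mathlib.AlgebraicGeometry.Morphisms.Proper
import Mathlib.AlgebraicGeometry.Noetherian
import Literature.AlgebraicGeometry.Resolution.ResolutionOfSingularities
import Literature.AlgebraicGeometry.Resolution.AlterationsLemma32
import Summits.ResolutionOfSingularities.ResolutionOfSingularities.Theorems.FrobeniusLadderFRationalResolutionAffineSpaceBirational
import HarnessLib

/-!
# Resolutions pull back along smooth morphisms
(crux `FrobeniusLadder.FRationalResolution`, line `Sketch`)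

Stub `hasResolution_of_smooth` of the skeleton `Sketch` for crux
stmt-ResolutionOfSingularities-15317 (theme: transfer tools for `Scheme.HasResolution`). If
`X` is locally Noetherian and admits a resolution of singularities `π : X' ⟶ X` (proper,
birational in the elementary sense of `Literature.AlgebraicGeometry.Resolution.IsBirational`,
regular source), then so does every `Y` smooth over `X`: for `g : Y ⟶ X` smooth, the base change
`ρ : Y' := X' ×_X Y ⟶ Y` of `π` along `g` is a resolution of `Y`:

* `ρ` is proper (base change of the proper `π`);
* `Y'` is regular: the projection `Y' ⟶ X'` is smooth (base change of `g`) and `X'` is regular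
  and locally Noetherian (`π` is locally of finite type over the locally Noetherian `X`), so
  EGA IV₄ 17.5.8 (iii) applies (`isRegularLocalRing_stalk_of_smooth`);
* `ρ` is birational with the dense open `g⁻¹(U)`, `U ⊆ X` the dense open of `π`: smooth
  morphisms are flat and locally of finite presentation, hence (universally) open
  (`UniversallyOpen.of_flat`, `Scheme.Hom.isOpenMap`), and preimages of dense sets under open
  maps are dense (`Dense.preimage`); `ρ⁻¹(g⁻¹(U)) = q⁻¹(π⁻¹(U))` for the open projection
  `q : Y' ⟶ X'`; and `ρ ∣_ g⁻¹(U)` is a base change of the isomorphism `π ∣_ U`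
  (`isIso_morphismRestrict_preimage_of_isPullback`).
-/

set_option linter.dupNamespace false

noncomputable section

open CategoryTheory CategoryTheory.Limits AlgebraicGeometry TopologicalSpace
  Literature.AlgebraicGeometry.Resolution

namespace Summit.ResolutionOfSingularities.ResolutionOfSingularities.Theorems.FRationalResolution

/-- RESOLUTIONS PULL BACK ALONG SMOOTH MORPHISMS. If a locally Noetherian scheme `X` admits a
resolution of singularities `π : X' ⟶ X`, then so does every scheme `Y` smooth over `X`: the
base change `X' ×_X Y ⟶ Y` of `π` along the smooth `g : Y ⟶ X` is proper, birational (smooth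
morphisms are open, so the dense open of `π` pulls back to a dense open) and has regular source
(smooth over the regular locally Noetherian `X'`, EGA IV₄ 17.5.8 (iii)).
[folklore; EGA IV₄ 17.5.8 (iii); Stacks 01UA (flat + lfp ⇒ universally open), 01W0, 01RN] -/
theorem hasResolution_of_smooth {X Y : Scheme.{0}} [IsLocallyNoetherian X] (g : Y ⟶ X) [Smooth g]
    (h : Scheme.HasResolution X) : Scheme.HasResolution Y := by
  obtain ⟨X', π, hπ⟩ := h
  haveI : IsProper π := hπ.isProper
  -- `X'` is locally Noetherian: `π` is locally of finite type over the locally Noetherian `X`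
  haveI : IsLocallyNoetherian X' := LocallyOfFiniteType.isLocallyNoetherian π
  -- the cartesian square `pullback.snd ≫ g = pullback.fst ≫ π`
  have H : IsPullback (pullback.snd π g) (pullback.fst π g) g π :=
    (IsPullback.of_hasPullback π g).flip
  refine ⟨pullback π g, pullback.snd π g, ⟨inferInstance, ?_, ?_⟩⟩
  · -- birational over `g ⁻¹ᵁ U`
    obtain ⟨U, hU, hU', hiso⟩ := hπ.isBirational
    refine ⟨g ⁻¹ᵁ U, ?_, ?_, ?_⟩
    · exact hU.preimage g.isOpenMap
    · have hpre : pullback.snd π g ⁻¹ᵁ (g ⁻¹ᵁ U) = pullback.fst π g ⁻¹ᵁ (π ⁻¹ᵁ U) := by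
        rw [← Scheme.Hom.comp_preimage, ← pullback.condition, Scheme.Hom.comp_preimage]
      rw [hpre]
      exact hU'.preimage (pullback.fst π g).isOpenMap
    · exact isIso_morphismRestrict_preimage_of_isPullback H U hiso
  · -- regular: `pullback.fst π g : pullback π g ⟶ X'` is smooth over the regular `X'`
    intro y
    exact isRegularLocalRing_stalk_of_smooth (pullback.fst π g) y (hπ.isRegular _)

end Summit.ResolutionOfSingularities.ResolutionOfSingularities.Theorems.FRationalResolution

end
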